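import Summits.BirchSwinnertonDyer.BirchSwinnertonDyer.Theses.PrintCf2
import Summits.BirchSwinnertonDyer.BirchSwinnertonDyer.Theorems.PrintCf2RamifiedOffTYZEvenOmegaIdentity
import HarnessLib

/-!
# Route `PrintCf2`, aside stmt-BirchSwinnertonDyer-26115 `RamifiedSelmerEightSixBSDTwoOfFacts` — CLOSER BY NAME

The aside filed by planner g22 (route A rev 53) under crux stmt-BirchSwinnertonDyer-20509 / item 23432: Smith's sector S(6) — for EVERY square-free
`n = 2p₁⋯p_k ≡ 6 (mod 8)` with `#Sel₂(E_n) = 8`: `ord_{s=1} L(E_n,s) = rank E_n(ℚ) = 1`, `Ш(E_n)[2^∞] = 0` and `BSD(E_n, 2)` — from the named facts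
`tyz_cmPointRingClassFrobeniusValueData ∧ thm11_parity_of_scriptL`.  Proved BY NAME by the cycle-15 theorem of the crux LEAD lineage (cruxlead-20509
g14, p754196 `MoverAssembly.selmerEight_six_bsdp_two_allk_of_facts`, through g13's `…EvenOmegaMover` and the kernel proof of the even Ω-identity).
Closer certified by the planner (`HOME/bsd-print-cf2-plan/routeA53/AsideEvenAll_v2.lean`) and landed by cruxlead-20509 g16.  CONDITIONAL on two named
facts without `_holds`; BSD is not proved by any of this; crux 20509 / item 23432 are NOT closed by this file.

References: [cite: TianYuanZhang2017, Thm. 1.1, §1 (p0002 L101–L110), §3 (Prop. 3.2 (2), Thm. 3.5, Thm. 3.6 (2), Lemma 3.18, proof of Lemma 3.21)];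
[cite: Cox2013, §5.C Thm. 5.23, Cor. 5.25, §9.A]; [cite: HeathBrown1994SelmerCongruentII, §1, Appendix (Monsky)]; [cite: Smith2016CongruentDensity, Thm. 1.4].
-/

set_option linter.dupNamespace false

namespace Summit.BirchSwinnertonDyer.BirchSwinnertonDyer.Theorems

/-- **Aside `RamifiedSelmerEightSixBSDTwoOfFacts` (stmt-BirchSwinnertonDyer-26115), by name**: granted
`tyz_cmPointRingClassFrobeniusValueData ∧ thm11_parity_of_scriptL`, for every square-free `n = 2p₁⋯p_k` with `∏pᵢ ≡ 3 (mod 4)` and `#Sel₂(E_n) = 8`: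
`ord_{s=1} L(E_n, s) = 1`, `rank E_n(ℚ) = 1`, `Ш(E_n)[2^∞] = 0` and `BSD(E_n, 2)`.
[cite: TianYuanZhang2017, Thm. 1.1 and §3 (Prop. 3.2 (2), Thm. 3.5, Thm. 3.6 (2), Lemma 3.18, proof of Lemma 3.21)] [cite: Cox2013, §5.C Cor. 5.25, §9.A] [cite: HeathBrown1994SelmerCongruentII, Appendix (Monsky)] -/
theorem ramifiedSelmerEightSixBSDTwoOfFacts_proof :
    Summit.BirchSwinnertonDyer.BirchSwinnertonDyer.Theses.PrintCf2.RamifiedSelmerEightSixBSDTwoOfFacts :=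
  fun hF _ p hp hodd hinj _ hn h3 hsq hsel =>
    Summit.BirchSwinnertonDyer.PrintCf2.MoverAssembly.selmerEight_six_bsdp_two_allk_of_facts p hp hodd hinj hF hn h3 hsq hsel

end Summit.BirchSwinnertonDyer.BirchSwinnertonDyer.Theorems
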